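import Summits.QuantumFields.YangMills.Theorems.BalabanUVNodesN19SizeByName
import Summits.QuantumFields.BalabanUV.T4Continuum.Spine.NE7.QLaCensusTorusMultiplicity

/-!
# BalabanUVNodes ∕ N19 — the (0.26) MULTIPLICITY binder (M) of the reference ledger DERIVED BY NAME from the tree's torus
# tree-decay census (`Spine.NE7.multiplicity_of_torusTreeDecay_sites` ⇐ (1.26) on the torus, `TreeLengthTorus.ineq126_torus`);
# knit v6 = v5 + (M) (seat dag-n19-a gen 3; Track A node N19, cluster K5 «SpineMatching»; count-neutral)

HONEST FRAMING.  NE7 is NOT PRINTED and NOT proved.  After knit v5 (`N19SizeByName`, p417754) the N19 edge on the term-wise road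
reads every DAG in-edge (N14 · N16 · N17 · N18 · N22) and [III] (2.43) BY NAME; among the remaining binders of the synchronised ledger
predicate `N19LedgerLinkSync.LedgerAtSync` the field `all_mult : ∀ K, Multiplicity (All K) scale (X ↦ e^{−κ·d X}) Cw vol Λg K` — the
(0.26)-type MULTIPLICITY of the τ-free reference ledger of localization domains ([Balaban1987RG1] (0.26) p. 257: Σ over the domains of
scale `j` of `e^{−κ d_j(X)}` is `≤ Cw·|T_1|·(L^d)^{K−j}`) — was still carried as «printed-grade».  The tree PROVES this census for any
ledger whose scale-`j` entries are (pairwise distinct) torus localization domains of the scale-`j` lattice with weights in the printed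
decay format and `κ ≥ κ₀(4·2^d, 2d)`: `Spine.NE7.multiplicity_of_torusTreeDecay_sites` (cell pub-balaban-gaps, seat ne7, files 36∕42∕44),
resting on the kernel-checked (1.26) `TreeLengthTorus.ineq126_torus` — [folklore] lattice geometry, no estimate of Bałaban's.

THIS FILE consumes it BY NAME:
* §1 [folklore] glue — `Multiplicity` ∕ `WindowMultiplicity` are monotone in the constants `(Cw, Λ)` (`multiplicity_mono_const`,
  `windowMultiplicity_mono_const`); re-indexing the scales by a run offset (`multiplicity_of_shift`).
* §2 `multiplicity_of_torusCensusFamily` — for a cutoff-indexed family of ledgers `fac K ⊆ D` with scales `sc` and weights `w`, a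
  cutoff-indexed family of lattice set-ups `Pf K : Params` of CONSTANT dimension `d₀`, block `L₀`, unit-lattice volume `vol` and
  `(Pf K).K = Koff + K` steps, and the DISPLAYED identification (m): every entry `X` of scale `j` is a non-empty face-connected family of
  sites of `T^{(j+Koff)}`, injectively per slice, with `0 ≤ w X ≤ E·e^{−κ·d(cells X)}` (`d` = the torus tree length), `κ ≥ κ₀(4·2^{d₀}, 2d₀)`
  ⇒ `∀ K, Multiplicity (fac K) sc w (E·K₀(4·2^{d₀}, 2d₀)) vol (L₀^{d₀}) K`.
* §3 knit v6 `core_summable_of_ledgerAtSync_multByName` = knit v5 with the ledger predicate demanded only FOR THE SIZE AND CENSUS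
  DATA SO SUPPLIED (`hL : ∀ S E₀ m a Cw Λg, size-clauses → census-clauses → LedgerAtSync {L with S, E₀, m, a, Cw, Λg} …` — i.e. its
  fields OTHER than size, `all_mult`, base signs), the reference ledger's census DERIVED (§2 at `E = 1`, `w X = e^{−κ·d X}`, identification
  (m) with `d(cells X) ≤ d X`), the recent node-U5b ledger's window census KEPT as the record's binder at its own `(L.Cw, L.Λg)` and
  merged by §1 at `(max L.Cw K₀, max L.Λg L₀^{d₀})`, then `core_summable_of_ledgerAtSync_sizeByName` (p417754) at the updated data ⇒
  `∃ δ, NE7.Core l₀ vol T Bad A B δ ∧ Summable δ` from [III] (2.43) · (1.26)-census · N14 · N16 · N17 · N18 · N22 BY NAME + (T) +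
  the displayed identifications + format∕booking.

One finite four-torus at fixed ε, rung (B)+1; NOT infinite volume, NOT OS on ℝ⁴, NOT a mass gap, NOT Clay.  Nothing of Bałaban's is
asserted or instantiated (WHICH domains form the reference ledger, and their cells, is NODE O ∕ the record); N19 is NOT discharged;
count-neutral.  THEOREMS ONLY; 0 sorry; standard axioms.

CITATION HEADER (LOCATIONS only).  [Balaban1987RG1] (0.25)–(0.26) p. 257 (`B12.chain026_holds`); [Balaban1988RG2Cluster] (1.26) p. 9
and [Dimock2013] App. A Lemma 25 (`B12TreeDecay`, `TreeLengthTorus.ineq126_torus`); [Balaban1988Convergent] Thm 2 (2.43) p. 263.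
-/

set_option autoImplicit false

noncomputable section

open Finset MeasureTheory
open scoped BigOperators

namespace Summit.QuantumFields.YangMills.BalabanUVNodes.N19MultiplicityByName

open Literature.MathematicalPhysics.QuantumFieldTheory.Balaban1983to89
open T4OutputRate T4RecentScale T4GoodClassBudget T4CauchySum T4TowerRateComposition T4TowerRateDischarge
open T4EtaRateMin (Readings NE3Shape)
open T4RateLiaison (GaugeDominated)
open TreeLengthTorus (TFaceConnected torusTreeLen)
open B12TreeDecay (kappa₀ K₀ K₀_pos kappa₀_nonneg)
open Summit.QuantumFields.BalabanUV.T4Continuum.Spine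
open Summit.QuantumFields.BalabanUV.T4Continuum.Spine.NE7 (multiplicity_of_torusTreeDecay_sites)
open Summit.QuantumFields.BalabanUV.T4Continuum.NE1p.DressedRoot (DressedTower DressedStabilityStrict)
open Summit.QuantumFields.YangMills.BalabanUVNodes.N19LedgerLinkSync (LedgerDataSync LedgerAtSync)
open Summit.QuantumFields.YangMills.BalabanUVNodes.N19SizeByName (core_summable_of_ledgerAtSync_sizeByName)

/-! ## §1 Glue: monotonicity of the census shapes in their constants; re-indexing by a run offset [folklore] -/

section Glue

variable {D : Type*} {fac : Finset D} {sc : D → ℕ} {w : D → ℝ} {Cw Cw' vol Λ Λ' : ℝ} {K jstar : ℕ}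

/-- `Multiplicity` is monotone in its constants: `Cw ≤ Cw′`, `0 ≤ Λ ≤ Λ′` (`Cw′, vol ≥ 0`). [folklore] -/
theorem multiplicity_mono_const (hvol : 0 ≤ vol) (hCw : Cw ≤ Cw') (hCw' : 0 ≤ Cw') (hΛ : 0 ≤ Λ) (hΛ' : Λ ≤ Λ')
    (h : Multiplicity fac sc w Cw vol Λ K) : Multiplicity fac sc w Cw' vol Λ' K := fun j hj =>
  (h j hj).trans (mul_le_mul (mul_le_mul_of_nonneg_right hCw hvol) (pow_le_pow_left₀ hΛ hΛ' _) (pow_nonneg hΛ _)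
    (mul_nonneg hCw' hvol))

/-- `WindowMultiplicity` is monotone in its constants likewise. [folklore] -/
theorem windowMultiplicity_mono_const (hvol : 0 ≤ vol) (hCw : Cw ≤ Cw') (hCw' : 0 ≤ Cw') (hΛ : 0 ≤ Λ) (hΛ' : Λ ≤ Λ')
    (h : WindowMultiplicity fac sc w Cw vol Λ jstar K) : WindowMultiplicity fac sc w Cw' vol Λ' jstar K := fun j hj hjK =>
  (h j hj hjK).trans (mul_le_mul (mul_le_mul_of_nonneg_right hCw hvol) (pow_le_pow_left₀ hΛ hΛ' _) (pow_nonneg hΛ _)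
    (mul_nonneg hCw' hvol))

/-- Re-indexing by a run offset: a census for the shifted scales `sc + Koff` at cutoff `Koff + K` is a census for `sc` at `K`. [folklore] -/
theorem multiplicity_of_shift {Koff : ℕ} (h : Multiplicity fac (fun X => sc X + Koff) w Cw vol Λ (Koff + K)) :
    Multiplicity fac sc w Cw vol Λ K := by
  intro j hj
  have h' := h (j + Koff) (by omega)
  have hset : fac.filter (fun X => sc X + Koff = j + Koff) = fac.filter (fun X => sc X = j) :=
    Finset.filter_congr fun X _ => by omega
  have hexp : Koff + K - (j + Koff) = K - j := by omega
  rw [hset, hexp] at h'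
  exact h'

end Glue

/-! ## §2 The (0.26) census of a cutoff-indexed ledger family from the torus tree-decay theorem, BY NAME -/

section Census

variable {D : Type*}

/-- **THE REFERENCE-LEDGER CENSUS BY NAME** [bookkeeping].  Data: ledgers `fac K ⊆ D` (cutoff `K`), scales `sc`, weights `w`; a family of
lattice set-ups `Pf K : Params` with CONSTANT dimension `d₀` and block `L₀`, `(Pf K).K = Koff + K` steps and unit-lattice volume `vol`
(`|T^{((Pf K).K)}| = vol`); `E ≥ 0`, `κ ≥ κ₀(4·2^{d₀}, 2d₀)`.  DISPLAYED identification (m): `cells K j X ⊆ T^{(j)}` with, for every entry `X`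
of `fac K`, `cells K (sc X + Koff) X` non-empty and face-connected, `cells K j` injective on each slice `{sc + Koff = j}`, and
`0 ≤ w X ≤ E·e^{−κ·torusTreeLen (cells K (sc X + Koff) X)}`.  CONCLUSION: `Multiplicity (fac K) sc w (E·K₀(4·2^{d₀}, 2d₀)) vol (L₀^{d₀}) K` for
every `K` — `Spine.NE7.multiplicity_of_torusTreeDecay_sites` (⇐ (1.26) on the torus) per cutoff, re-based and re-indexed (§1). [folklore] -/
theorem multiplicity_of_torusCensusFamily (fac : ℕ → Finset D) (sc : D → ℕ) (w : D → ℝ) (Pf : ℕ → Params)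
    {d₀ L₀ Koff : ℕ} {vol E κ : ℝ}
    (hPd : ∀ K, (Pf K).d = d₀) (hPL : ∀ K, (Pf K).L = L₀) (hPK : ∀ K, (Pf K).K = Koff + K)
    (hcard : ∀ K, (Fintype.card (Site (Pf K) (Pf K).K) : ℝ) = vol)
    (hE : 0 ≤ E) (hκ : kappa₀ (4 * 2 ^ d₀) (2 * d₀) ≤ κ)
    (cells : (K j : ℕ) → D → Finset (Site (Pf K) j))
    (hdom : ∀ K, ∀ X ∈ fac K, (cells K (sc X + Koff) X).Nonempty ∧ TFaceConnected (cells K (sc X + Koff) X))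
    (hinj : ∀ K j, Set.InjOn (cells K j) ↑((fac K).filter fun X => sc X + Koff = j))
    (hw0 : ∀ K, ∀ X ∈ fac K, 0 ≤ w X)
    (hw : ∀ K, ∀ X ∈ fac K, w X ≤ E * Real.exp (-κ * torusTreeLen (cells K (sc X + Koff) X))) :
    ∀ K, Multiplicity (fac K) sc w (E * K₀ (4 * 2 ^ d₀) (2 * d₀)) vol ((L₀ : ℝ) ^ d₀) K := by
  intro K
  have hκ' : kappa₀ (4 * 2 ^ (Pf K).d) (2 * (Pf K).d) ≤ κ := by rw [hPd K]; exact hκ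
  have h := multiplicity_of_torusTreeDecay_sites (P := Pf K) (fac K) (fun X => sc X + Koff) (cells K) w hE hκ' (hdom K)
    (hinj K) (hw0 K) (hw K)
  rw [hcard K, hPK K, hPd K, hPL K] at h
  exact multiplicity_of_shift h

end Census

/-! ## §3 Knit v6: the N19 edge with (S) AND (M) BY NAME -/

section Edge

variable {C : Carriers} [DecidableEq C.Dom] {F : Type*} {ι X : Type} [MeasurableSpace ι] {σ : Type*} [DecidableEq σ]
  {L : LedgerDataSync C F ι σ} {l₀ vol : ℝ} {T : ℕ → Finset σ} {Bad : ℕ → ℝ → Finset σ} {A B : ℕ → ℝ → σ → ℝ}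
  {R : Readings ι X} {W : Set (ℕ → ℝ)} {EA : Functional C C.BgA} {EB : Functional C C.BgB}
  {κ θ₅ C₅ C₉ ω θc Cd γ C₃ θ₃ Pg : ℝ} {q : ℕ} {Λm : ℕ → ℕ → ℝ} {CU : (ℕ → ℝ) → ℕ → ℝ}
  {g : ℕ → ℕ → ℝ} {uA : ℕ → ι → C.BgA} {uB : ℕ → ι → C.BgB}

/-- **KNIT v6 — THE N19 EDGE WITH THE ONE-RUN SIZE AND THE (0.26) CENSUS BY NAME** [bookkeeping].  Hypotheses: `hL` — the synchronised
ledger predicate HOLDS FOR WHATEVER SIZE DATA `(S, E₀, m, a)` AND CENSUS CONSTANTS `(Cw, Λg)` meet the size clauses, the two census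
clauses (reference ledger `All K`, weights `e^{−κ·d X}`; recent node-U5b ledger on the log window) and the base signs `1 ≤ Λg`, `θ′ ≤ Λg`
(equivalently: its OTHER fields — term format, reference-ledger inclusion and scales, booking, other kinds, rate ordering, `one` — hold;
NODE O); `0 ≤ vol`; the record's own window census of the U5b ledger at `(L.Cw, L.Λg)` with `0 ≤ L.Cw`, `1 ≤ L.Λg`, `L.θ′ ≤ L.Λg`; the
reference ledger's lattice identification (m) of §2 with `E = 1`, weights `e^{−κ·d X}` and `torusTreeLen (cells …) ≤ d X`,
`κ ≥ κ₀(4·2^{d₀}, 2d₀)`; and — verbatim as in knit v5 `core_summable_of_ledgerAtSync_sizeByName` — [III] Thm 2 (2.43) AS PRINTED, node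
N14's pinned pair, the identifications (v-A)(v-B)(d), and the in-edges N16 · N17 · N18 · N22 + (T) + window memberships.  CONCLUSION:
`∃ δ, Spine.NE7.Core l₀ vol T Bad A B δ ∧ Summable δ`.  PROOF: §2 gives `Multiplicity (L.All K) scale (e^{−κ·d}) K₀ vol L₀^{d₀} K`; §1 moves
both censuses to `(max L.Cw K₀, max L.Λg L₀^{d₀})`; knit v5 at `{L with Cw, Λg := those}`.  CONDITIONAL on every binder; NOT NE7. [folklore] -/
theorem core_summable_of_ledgerAtSync_multByName
    (hL : ∀ (S : ℕ → ℝ → σ → ℕ → ℝ) (E₀ : ℝ) (m : ℕ) (a : ℝ) (Cw Λg : ℝ),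
      (∀ K t, |t| ≤ l₀ → ∀ τ ∈ T K \ Bad K t, ∀ v ∈ R.dom, ∀ j ≤ K,
        |∑ X ∈ L.fac K t τ with C.scale X = j,
            (Real.log (Real.exp (EB (fun i => g (K + 1) (i + 1)) (uB K v) X
                - EB (fun i => g (K + 1) (i + 1)) L.oneB X))
              - Real.log (Real.exp (EA (g K) (uA K v) X - EA (g K) L.oneA X)))| ≤ S K t τ j) →
      0 ≤ E₀ → 0 < a → a < 1 →
      (∀ K t, |t| ≤ l₀ → ∀ τ ∈ T K \ Bad K t, ∀ j ≤ K,
        S K t τ j ≤ vol * (E₀ * ((K : ℝ) + 1) ^ m * a ^ (K - j))) →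
      (∀ K, Multiplicity (L.All K) C.scale (fun X => Real.exp (-(κ * C.d X))) Cw vol Λg K) →
      (∀ K t, |t| ≤ l₀ → ∀ τ ∈ T K \ Bad K t,
        WindowMultiplicity (L.facO K t τ) L.scO L.wO Cw vol Λg (jlogOf L.Cl K) K) →
      1 ≤ Λg → L.θ' ≤ Λg →
      LedgerAtSync { L with S := S, E₀ := E₀, m := m, a := a, Cw := Cw, Λg := Λg } l₀ vol T Bad A B R EA EB κ g uA uB
        ω θc θ₅ θ₃)
    (hvol : 0 ≤ vol)
    -- the record's own window census of the recent node-U5b ledger and its base letters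
    (homult : ∀ K t, |t| ≤ l₀ → ∀ τ ∈ T K \ Bad K t,
      WindowMultiplicity (L.facO K t τ) L.scO L.wO L.Cw vol L.Λg (jlogOf L.Cl K) K)
    (hCw : 0 ≤ L.Cw) (hΛg : 1 ≤ L.Λg) (hθΛ : L.θ' ≤ L.Λg)
    -- (m) the reference ledger's lattice identification, per cutoff
    (Pf : ℕ → Params) {d₀ L₀ Koff : ℕ}
    (hPd : ∀ K, (Pf K).d = d₀) (hPL : ∀ K, (Pf K).L = L₀) (hPK : ∀ K, (Pf K).K = Koff + K)
    (hcard : ∀ K, (Fintype.card (Site (Pf K) (Pf K).K) : ℝ) = vol)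
    (hκ₀ : kappa₀ (4 * 2 ^ d₀) (2 * d₀) ≤ κ)
    (cells : (K j : ℕ) → C.Dom → Finset (Site (Pf K) j))
    (hdom : ∀ K, ∀ X ∈ L.All K, (cells K (C.scale X + Koff) X).Nonempty ∧ TFaceConnected (cells K (C.scale X + Koff) X))
    (hinj : ∀ K j, Set.InjOn (cells K j) ↑((L.All K).filter fun X => C.scale X + Koff = j))
    (hlen : ∀ K, ∀ X ∈ L.All K, torusTreeLen (cells K (C.scale X + Koff) X) ≤ C.d X)
    -- [III] Theorem 2 (2.43) AS PRINTED, one family containing both runs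
    (H033 : Flow → ℕ → Prop) {I : Type} (fam : I → B14.Sect2Data) {Lb β : ℝ} {κ₁ : ℕ}
    (h11 : B14.Thm2Printed H033 fam Lb β κ₁) (hβ1 : β < 1) (hβ0 : 0 < β) (hLb : 1 < Lb)
    {Gv Cl : ℝ} (hGv : 1 ≤ Gv) (hCl : 0 ≤ Cl) (K₁ : ℕ)
    -- node N14, the pinned pair
    {P : Type*} {𝒯 : DressedTower P} {Λ Λ₀ N₀ : ℝ}
    (h14 : DressedStabilityStrict 𝒯 Λ ∧ ∀ p K, (𝒯.B p K).PositionalCount fun j k => N₀ * Λ₀ ^ (k - j))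
    (hN₀ : 0 ≤ N₀) (hΛ₀ : 0 ≤ Λ₀) (hle : Λ₀ ≤ Λ)
    (dressed : C.Dom → Prop) [DecidablePred dressed]
    -- (v-A) run A's vacuum slices ↔ printed E-terms
    (hidA : ∀ K t, |t| ≤ l₀ → ∀ τ ∈ T K \ Bad K t, ∀ v ∈ R.dom, ∀ j ≤ K, ∃ (i : I) (w : (fam i).Ω) (j' : ℕ),
      (fam i).flow.SatisfiesRG (fam i).K ∧ H033 (fam i).flow (fam i).K ∧ 1 ≤ j' ∧ j' ≤ (fam i).K ∧
      (fam i).K - j' = K - j ∧ (fam i).K ≤ K + K₁ ∧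
      (∀ n, 0 ≤ (fam i).gammaVol n w) ∧ (fam i).gammaVol (fam i).K w ≤ vol ∧
      (∀ n, n < (fam i).K → n < jlogOf Cl (fam i).K → (fam i).gammaVol n w = 0) ∧
      (∀ n, n < (fam i).K → jlogOf Cl (fam i).K ≤ n → (fam i).gammaVol n w ≤ vol * Gv ^ ((fam i).K - n)) ∧
      |∑ X ∈ (L.fac K t τ).filter (fun X => ¬ dressed X) with C.scale X = j,
          (EA (g K) (uA K v) X - EA (g K) L.oneA X)| ≤ |(fam i).eTerm j' (fam i).K w|)
    -- (v-B) run B's vacuum slices ↔ printed E-terms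
    (hidB : ∀ K t, |t| ≤ l₀ → ∀ τ ∈ T K \ Bad K t, ∀ v ∈ R.dom, ∀ j ≤ K, ∃ (i : I) (w : (fam i).Ω) (j' : ℕ),
      (fam i).flow.SatisfiesRG (fam i).K ∧ H033 (fam i).flow (fam i).K ∧ 1 ≤ j' ∧ j' ≤ (fam i).K ∧
      (fam i).K - j' = K - j ∧ (fam i).K ≤ K + K₁ ∧
      (∀ n, 0 ≤ (fam i).gammaVol n w) ∧ (fam i).gammaVol (fam i).K w ≤ vol ∧
      (∀ n, n < (fam i).K → n < jlogOf Cl (fam i).K → (fam i).gammaVol n w = 0) ∧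
      (∀ n, n < (fam i).K → jlogOf Cl (fam i).K ≤ n → (fam i).gammaVol n w ≤ vol * Gv ^ ((fam i).K - n)) ∧
      |∑ X ∈ (L.fac K t τ).filter (fun X => ¬ dressed X) with C.scale X = j,
          (EB (fun i => g (K + 1) (i + 1)) (uB K v) X - EB (fun i => g (K + 1) (i + 1)) L.oneB X)|
        ≤ |(fam i).eTerm j' (fam i).K w|)
    -- (d) the dressed sub-ledger ↔ N14's bookings
    (hidD : ∀ K t, |t| ≤ l₀ → ∀ τ ∈ T K \ Bad K t, ∀ v ∈ R.dom,
      ∃ (pA : P) (βA : C.Dom → (𝒯.B pA K).Birth) (Q : Finset (𝒯.B pA K).Cube) (pB : P) (KB : ℕ)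
        (βB : C.Dom → (𝒯.B pB KB).Birth),
      (∀ X ∈ (L.fac K t τ).filter (fun X => dressed X), (𝒯.B pA K).birthScale (βA X) = C.scale X) ∧
      (∀ j, Set.InjOn βA ↑(((L.fac K t τ).filter (fun X => dressed X)).filter fun X => C.scale X = j)) ∧
      (∀ c ∈ Q, (𝒯.B pA K).cubeScale c = K) ∧ ((Q.card : ℝ) ≤ vol) ∧
      (∀ X ∈ (L.fac K t τ).filter (fun X => dressed X), ∃ c ∈ Q, βA X ∈ (𝒯.B pA K).feltAt c) ∧
      (∀ X ∈ (L.fac K t τ).filter (fun X => dressed X), KB - (𝒯.B pB KB).birthScale (βB X) = K - C.scale X) ∧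
      (∀ X ∈ (L.fac K t τ).filter (fun X => dressed X),
        |EA (g K) (uA K v) X - EA (g K) L.oneA X| ≤ (𝒯.B pA K).size (βA X) K) ∧
      (∀ X ∈ (L.fac K t τ).filter (fun X => dressed X),
        |EB (fun i => g (K + 1) (i + 1)) (uB K v) X - EB (fun i => g (K + 1) (i + 1)) L.oneB X|
          ≤ (𝒯.B pB KB).size (βB X) KB))
    -- the in-edges BY NAME and the bracket (T), as in `core_summable_of_ledgerAtSync`
    (h16 : NE3Shape R C₃ θ₃) (hC₃ : 0 ≤ C₃) (hgd : GaugeDominated R uA uB)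
    (h18 : NE5 EA EB W κ θ₅ C₅) (hθ₅ : 0 ≤ θ₅) (hC₅ : 0 ≤ C₅)
    (h22 : NE9 EA W κ Λm ∧ T4OutputRate.FadingMemory C₉ ω Λm) (hω : 0 ≤ ω)
    (hinj17 : InjectedRate Cd 0 θc (fun K j => T4CouplingMatching.disc (g K) (g (K + 1)) j)) (hCd : 0 ≤ Cd)
    (hθc : 0 ≤ θc) (hbox : ∀ K i, i ≤ K → 0 < g K i ∧ g K i ≤ γ)
    (hU : LipBackground EA W κ CU) (hG : PolyLipGrowth CU g Pg q) (hPg : 0 ≤ Pg)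
    (hgA : ∀ K, g K ∈ W) (hgB : ∀ K, (fun i => g (K + 1) (i + 1)) ∈ W) :
    ∃ δ : ℕ → ℝ, NE7.Core l₀ vol T Bad A B δ ∧ Summable δ := by
  -- the reference ledger's census from the torus tree-decay theorem
  have hκ0 : 0 ≤ κ := (kappa₀_nonneg (by positivity) _).trans hκ₀
  have hmult : ∀ K, Multiplicity (L.All K) C.scale (fun X => Real.exp (-(κ * C.d X))) (1 * K₀ (4 * 2 ^ d₀) (2 * d₀)) vol
      ((L₀ : ℝ) ^ d₀) K :=
    multiplicity_of_torusCensusFamily L.All C.scale (fun X => Real.exp (-(κ * C.d X))) Pf hPd hPL hPK hcard zero_le_one hκ₀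
      cells hdom hinj (fun K X _ => Real.exp_nonneg _) fun K X hX => by
        rw [one_mul]
        exact Real.exp_le_exp.mpr (by nlinarith [hlen K X hX])
  -- common constants for the two censuses
  set Cw' : ℝ := max L.Cw (1 * K₀ (4 * 2 ^ d₀) (2 * d₀)) with hCw'
  set Λ' : ℝ := max L.Λg ((L₀ : ℝ) ^ d₀) with hΛ'
  have hCw'0 : 0 ≤ Cw' := hCw.trans (le_max_left _ _)
  have hΛg0 : 0 ≤ L.Λg := zero_le_one.trans hΛg
  have hL₀0 : (0 : ℝ) ≤ (L₀ : ℝ) ^ d₀ := by positivity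
  have hmult' : ∀ K, Multiplicity (L.All K) C.scale (fun X => Real.exp (-(κ * C.d X))) Cw' vol Λ' K := fun K =>
    multiplicity_mono_const hvol (le_max_right _ _) hCw'0 hL₀0 (le_max_right _ _) (hmult K)
  have homult' : ∀ K t, |t| ≤ l₀ → ∀ τ ∈ T K \ Bad K t,
      WindowMultiplicity (L.facO K t τ) L.scO L.wO Cw' vol Λ' (jlogOf L.Cl K) K := fun K t ht τ hτ =>
    windowMultiplicity_mono_const hvol (le_max_left _ _) hCw'0 hΛg0 (le_max_left _ _) (homult K t ht τ hτ)
  have h1 : 1 ≤ Λ' := hΛg.trans (le_max_left _ _)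
  have hθ : L.θ' ≤ Λ' := hθΛ.trans (le_max_left _ _)
  -- knit v5 at the updated census data
  exact core_summable_of_ledgerAtSync_sizeByName (L := { L with Cw := Cw', Λg := Λ' })
    (fun S E₀ m a hsz hE₀ ha0 ha1 hprof => hL S E₀ m a Cw' Λ' hsz hE₀ ha0 ha1 hprof hmult' homult' h1 hθ)
    hvol H033 fam h11 hβ1 hβ0 hLb hGv hCl K₁ h14 hN₀ hΛ₀ hle dressed hidA hidB hidD h16 hC₃ hgd h18 hθ₅ hC₅ h22 hω hinj17
    hCd hθc hbox hU hG hPg hgA hgB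

end Edge

/-! ## §4 Guard: the identification (m) of §2 is jointly satisfiable, non-degenerately [decided toy] -/

section Toy

/-- **§2 FIRES ON A TOY** [decided toy]: one domain of scale `0` and weight `1` per cutoff, lattice set-ups `(d, L, m, K) = (1, 3, 0, K)`
(unit lattice of `2` sites, offset `0`), the domain's cell family = one site of `T^{(0)}` (non-empty, face-connected, torus tree length `0`),
`E = 1`, `κ = κ₀(8, 2)`: EVERY binder of `multiplicity_of_torusCensusFamily` is met and the census reads `1 ≤ K₀(8,2)·2·3^{K}` at the one
non-empty slice.  No physics. [folklore] -/
theorem multiplicity_toy (K : ℕ) :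
    Multiplicity ({()} : Finset Unit) (fun _ => 0) (fun _ => (1 : ℝ)) (1 * K₀ (4 * 2 ^ 1) (2 * 1)) 2 (((3 : ℕ) : ℝ) ^ 1) K := by
  have hP : ∀ K : ℕ, Odd 3 ∧ 1 < 3 := fun _ => ⟨⟨1, rfl⟩, by norm_num⟩
  set Pf : ℕ → Params := fun K => ⟨1, 3, 0, K, le_rfl, hP K⟩ with hPf
  -- the one cell: the zero site of `T^{(j)}`
  set z : (K j : ℕ) → Site (Pf K) j := fun K j => fun _ => 0 with hz
  have hlen : ∀ K j, torusTreeLen ({z K j} : Finset (Site (Pf K) j)) = 0 := fun K j =>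
    TreeLengthTorus.torusTreeLen_singleton (z K j)
  have hconn : ∀ K j, TFaceConnected ({z K j} : Finset (Site (Pf K) j)) := by
    intro K j x hx y hy
    obtain rfl : x = z K j := Finset.mem_singleton.mp hx
    obtain rfl : y = z K j := Finset.mem_singleton.mp hy
    exact Relation.ReflTransGen.refl
  refine multiplicity_of_torusCensusFamily (fun _ => ({()} : Finset Unit)) (fun _ => 0) (fun _ => (1 : ℝ)) Pf
    (d₀ := 1) (L₀ := 3) (Koff := 0) (vol := 2) (E := 1) (κ := kappa₀ (4 * 2 ^ 1) (2 * 1))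
    (fun _ => rfl) (fun _ => rfl) (fun K => (Nat.zero_add K).symm) (fun K => ?_) zero_le_one le_rfl
    (fun K j _ => {z K j}) (fun K X _ => ⟨Finset.singleton_nonempty _, hconn K _⟩)
    (fun K j a _ b _ _ => Subsingleton.elim a b) (fun _ _ _ => zero_le_one) (fun K X _ => ?_) K
  · rw [Site.card_site]
    simp [hPf, Params.sitesPerDir]
  · rw [hlen K, mul_zero, Real.exp_zero, mul_one]

end Toy

end Summit.QuantumFields.YangMills.BalabanUVNodes.N19MultiplicityByName

end
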